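import Mathlib
import Literature.NumberTheory.Transcendental.KZCubeRational
import Summits.KontsevichZagierPeriods.KontsevichZagierPeriods.Theorems.ScissorsTransportPolytopeTransportPoly
import Summits.KontsevichZagierPeriods.KontsevichZagierPeriods.Theorems.InverseLandauTateFamilyKernelOpenCube
import Summits.KontsevichZagierPeriods.KontsevichZagierPeriods.Theorems.InverseLandauTateFamilyKernelStubLinExact

/-!
# Crux `TateFamilyKernel` (stmt-KontsevichZagierPeriods-9130), line `Sketch` — stub `stub_linExactW`

LINEAR CLASS of the lead's skeleton (dimension `2`, `Q = 1 − ϖ(α + βz₂)z₁`, `0 < α`, `0 < β`) with a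
`ϖ`-DEPENDENT numerator `P ∈ ℚ[z₁, z₂, ϖ]`: Griffiths exactness AT THE FIBRE `ϖ₀ > 0`.
Write `x = z₁ = X 0`, `s = z₂ = X 1`, `ϖ = X (Fin.last 2)`, `W = α + βs` (`> 0` on `[0,1]`),
`U = ϖW`, `Q = 1 − Ux`, `T = Wx`. The data handed over: the reversed polynomial `P̃ ∈ ℚ[x, s]`
(`P̃(z) = T^{M₀} P(z, 1/T)` wherever `T ≠ 0`) and a rational `s`-primitive `M(y,s)/W^k` of
`P̃(y/W, s)/W`; in algebraic form (uniqueness of derivatives, `LinExact.key_identity`)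
`P̃(y/W, s)·W^k = (∂_s M)(y,s)·W − kβ·M(y,s)`.

The certificate (three Griffiths terms, `ℚ`-polynomial data in `(x, s, ϖ)`):
* DIVISION in `x` (`LinExactW.div_rem`, the geometric sum): `U^N P = q·Q + R` in `ℚ[x,s,ϖ]` with `R`
  free of `x`; so `P/Q = q/U^N + r/Q`, `r = R/U^N`, and evaluating at the polar point `x = 1/U`
  (where `T = 1/ϖ₀`) gives `r(s) = P(1/U, s, ϖ₀) = ϖ₀^{M₀} P̃(ϖ₀⁻¹/W, s)` by the reversal identity;
* the polynomial part `q/U^N = ∂_x (antider q / U^N)` (first term, denominator `U^N`);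
* the polar part: with `Φ(s) = ϖ₀^{M₀} M(ϖ₀⁻¹, s)/W^k` one has `WΦ' = r` (the residue datum at
  `y = ϖ₀⁻¹`), and the divergence-free field `V = −βx∂_x + W∂_s` kills `U x`, so
  `r/Q = V(Φ)/Q = ∂_x(−βxΦ/Q) + ∂_s(WΦ/Q)`; clearing `W^{k+1}` and the powers of `ϖ₀⁻¹`
  (`LinExactW.yrev`: `M̂(s, ϖ) = ϖ^{N'} M(1/ϖ, s)` is a polynomial) these are the second and third
  terms `A = −βxW·ϖ^{M₀}M̂`, `A = W²·ϖ^{M₀}M̂` over `D = ϖ^{N'} W^{k+1} Q`.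
All denominators are products of `ϖ`, `W`, `Q`, nonvanishing on the closed square at `ϖ₀`.
The verification is symbolic differentiation (`pderiv`), evaluation, and one rational identity.
The helpers `LinExact.key_identity`, `LinExact.hasDerivAt_aeval_snd` of the `ϖ`-free stub
(`…StubLinExact.lean`, p141821) are reused; the division and the reversal are `LinExactW.div_rem`,
`LinExactW.yrev`; the `x`-primitive is `antider` (`…ScissorsTransportPolytopeTransportPoly.lean`).
No named fact, no new definition. References: Kontsevich–Zagier 2001 §1.2 (rule (3), Stokes); Griffiths 1969.
-/

noncomputable section

open MeasureTheory Set MvPolynomial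
open Literature.NumberTheory.Transcendental
open Summit.KontsevichZagierPeriods.ScissorsTransport.PolytopeTransport (antider pderiv_antider)

namespace Summit.KontsevichZagierPeriods.InverseLandau.TateFamilyKernel.Descent

namespace LinExactW

/-- **Division with remainder by `1 − U·X₀` in the variable `X₀`** (geometric sum). If `U` does
not involve `X₀` (in evaluation), then for every `P` there are `N`, `q` and an `X₀`-free `R` with
`U^N · P = q · (1 − U X₀) + R`. [folklore] -/
theorem div_rem (U : MvPolynomial (Fin (2 + 1)) ℚ)
    (hU : ∀ (f : Fin (2 + 1) → ℝ) (t : ℝ), aeval (Function.update f 0 t) U = aeval f U)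
    (P : MvPolynomial (Fin (2 + 1)) ℚ) :
    ∃ (N : ℕ) (q R : MvPolynomial (Fin (2 + 1)) ℚ), U ^ N * P = q * (1 - U * X 0) + R ∧
      ∀ (f : Fin (2 + 1) → ℝ) (t : ℝ), aeval (Function.update f 0 t) R = aeval f R := by
  induction P using MvPolynomial.induction_on with
  | C a => exact ⟨0, 0, C a, by ring, fun f t => by simp⟩
  | add p₁ p₂ h₁ h₂ =>
    obtain ⟨N₁, q₁, R₁, h₁, hR₁⟩ := h₁
    obtain ⟨N₂, q₂, R₂, h₂, hR₂⟩ := h₂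
    refine ⟨N₁ + N₂, U ^ N₂ * q₁ + U ^ N₁ * q₂, U ^ N₂ * R₁ + U ^ N₁ * R₂, ?_, fun f t => ?_⟩
    · linear_combination U ^ N₂ * h₁ + U ^ N₁ * h₂
    · simp only [map_add, map_mul, map_pow, hU, hR₁, hR₂]
  | mul_X p i h =>
    obtain ⟨N, q, R, h, hR⟩ := h
    by_cases hi : i = 0
    · subst hi
      exact ⟨N + 1, U * X 0 * q - R, R, by linear_combination (U * X 0) * h, hR⟩
    · refine ⟨N, q * X i, R * X i, by linear_combination (X i) * h, fun f t => ?_⟩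
      simp only [map_mul, aeval_X, hR, Function.update_of_ne hi]

/-- **Reversal in the first variable.** For `M ∈ ℚ[y, s]` there are `N` and `M̂ ∈ ℚ[x, s, ϖ]` with
`M̂(x, s, ϖ) = ϖ^N · M(1/ϖ, s)` at every real point with `ϖ ≠ 0`. [folklore] -/
theorem yrev (M : MvPolynomial (Fin 2) ℚ) :
    ∃ (N : ℕ) (Mr : MvPolynomial (Fin (2 + 1)) ℚ), ∀ f : Fin (2 + 1) → ℝ, f (Fin.last 2) ≠ 0 →
      aeval f Mr = f (Fin.last 2) ^ N * aeval ![(f (Fin.last 2))⁻¹, f 1] M := by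
  induction M using MvPolynomial.induction_on with
  | C a => exact ⟨0, C a, fun f _ => by simp⟩
  | add p₁ p₂ h₁ h₂ =>
    obtain ⟨N₁, R₁, h₁⟩ := h₁
    obtain ⟨N₂, R₂, h₂⟩ := h₂
    refine ⟨N₁ + N₂, X (Fin.last 2) ^ N₂ * R₁ + X (Fin.last 2) ^ N₁ * R₂, fun f hf => ?_⟩
    rw [map_add, map_mul, map_mul, map_pow, map_pow, aeval_X, h₁ f hf, h₂ f hf, map_add]
    ring
  | mul_X p i h =>
    obtain ⟨N, R, h⟩ := h
    fin_cases i
    · refine ⟨N + 1, R, fun f hf => ?_⟩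
      rw [h f hf]
      simp only [Fin.zero_eta, map_mul, aeval_X, Matrix.cons_val_zero]
      rw [pow_succ]
      field_simp
    · refine ⟨N, R * X 1, fun f hf => ?_⟩
      simp only [Fin.mk_one, map_mul, aeval_X, Matrix.cons_val_one, Matrix.cons_val_fin_one, h f hf]
      ring

end LinExactW

open LinExact LinExactW in
/-- **Linear class with a `ϖ`-dependent numerator, exactness at the fibre** (stub `stub_linExactW`
of the crux `TateFamilyKernel`, line `Sketch`). For `Q = 1 − ϖ(α + βz₂)z₁` with `0 < α`, `0 < β`,
any `P ∈ ℚ[z₁, z₂, ϖ]` with reversed polynomial `P̃` (`P̃(z) = T^{M₀}P(z, 1/T)`, `T = (α + βz₂)z₁`)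
and the residue datum `d/ds (M(y,s)/W^k) = P̃(y/W, s)/W` (`W = α + βs`), the fibre `P/Q(·, ϖ₀)` at
`ϖ₀ > 0` is Griffiths-exact on the closed square with `ℚ`-polynomial data regular there:
`P/Q = ∂_{z₁}(antider q/U^N) + ∂_{z₁}(A₁/D) + ∂_{z₂}(A₂/D)` at `ϖ₀`, where `U = ϖW`,
`U^N P = qQ + R` (division in `z₁`), `A₁ = −βz₁W·ϖ^{M₀}M̂`, `A₂ = W²·ϖ^{M₀}M̂`, `D = ϖ^{N'}W^{k+1}Q`,
`M̂ = ϖ^{N'}M(1/ϖ, z₂)` (the field `−βz₁∂₁ + W∂₂` applied to `ϖ₀^{M₀}M(ϖ₀⁻¹, z₂)/W^k`, times `1/Q`,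
reproduces the remainder `R/U^N` because `R/U^N = P(1/U, z₂, ϖ₀) = ϖ₀^{M₀}P̃(ϖ₀⁻¹/W, z₂)`).
[cite: KontsevichZagier2001, §1.2] -/
theorem stub_linExactW (α β : ℚ) (P : MvPolynomial (Fin (2 + 1)) ℚ) (hα : 0 < α) (hβ : 0 < β)
    (M₀ : ℕ) (Pt : MvPolynomial (Fin 2) ℚ)
    (hPt : ∀ z : Fin 2 → ℝ, ((α : ℝ) + β * z 1) * z 0 ≠ 0 →
      aeval z Pt = (((α : ℝ) + β * z 1) * z 0) ^ M₀ *
        aeval (Fin.snoc z ((((α : ℝ) + β * z 1) * z 0)⁻¹) : Fin (2 + 1) → ℝ) P)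
    (k : ℕ) (M : MvPolynomial (Fin 2) ℚ)
    (hM : ∀ (y s : ℝ), (α : ℝ) + β * s ≠ 0 →
      HasDerivAt (fun s' : ℝ => aeval ![y, s'] M / ((α : ℝ) + β * s') ^ k)
        (aeval ![y / ((α : ℝ) + β * s), s] Pt / ((α : ℝ) + β * s)) s)
    (ϖ₀ : ℝ) (hϖ₀ : 0 < ϖ₀)
    (hQ : ∀ w ∈ KZ.cube 2, aeval (Fin.snoc w ϖ₀ : Fin (2 + 1) → ℝ)
      (1 - X (Fin.last 2) * (C α + C β * X 1) * X 0 : MvPolynomial (Fin (2 + 1)) ℚ) ≠ 0) :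
    ∃ (K : ℕ) (i : Fin K → Fin 2) (A Dn : Fin K → MvPolynomial (Fin (2 + 1)) ℚ),
      (∀ k, ∀ w ∈ KZ.cube 2, aeval (Fin.snoc w ϖ₀ : Fin (2 + 1) → ℝ) (Dn k) ≠ 0) ∧
      (∀ w ∈ KZ.cube 2,
        aeval (Fin.snoc w ϖ₀ : Fin (2 + 1) → ℝ) P /
            aeval (Fin.snoc w ϖ₀ : Fin (2 + 1) → ℝ)
              (1 - X (Fin.last 2) * (C α + C β * X 1) * X 0 : MvPolynomial (Fin (2 + 1)) ℚ) =
          ∑ k, aeval (Fin.snoc w ϖ₀ : Fin (2 + 1) → ℝ)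
              (pderiv (Fin.castSucc (i k)) (A k) * Dn k - A k * pderiv (Fin.castSucc (i k)) (Dn k)) /
            aeval (Fin.snoc w ϖ₀ : Fin (2 + 1) → ℝ) (Dn k ^ 2)) := by
  -- the polynomial data (`X 0 = z₁ = x`, `X 1 = z₂ = s`, `X (Fin.last 2) = ϖ`)
  obtain ⟨W, hW⟩ : ∃ W : MvPolynomial (Fin (2 + 1)) ℚ, W = C α + C β * X 1 := ⟨_, rfl⟩
  obtain ⟨U, hU⟩ : ∃ U : MvPolynomial (Fin (2 + 1)) ℚ, U = X (Fin.last 2) * W := ⟨_, rfl⟩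
  obtain ⟨Qp, hQp⟩ : ∃ Qp : MvPolynomial (Fin (2 + 1)) ℚ, Qp = 1 - U * X 0 := ⟨_, rfl⟩
  have hQp' :
      (1 - X (Fin.last 2) * (C α + C β * X 1) * X 0 : MvPolynomial (Fin (2 + 1)) ℚ) = Qp := by
    rw [hQp, hU, hW]
  rw [hQp'] at hQ ⊢
  have h10 : (1 : Fin (2 + 1)) ≠ 0 := by decide
  have hL0 : (Fin.last 2 : Fin (2 + 1)) ≠ 0 := by decide
  have hL1 : (Fin.last 2 : Fin (2 + 1)) ≠ 1 := by decide
  -- division of `P` by `Qp` in `x`, reversal of `M` in `y`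
  have hUx : ∀ (f : Fin (2 + 1) → ℝ) (t : ℝ), aeval (Function.update f 0 t) U = aeval f U := by
    intro f t
    simp only [hU, hW, map_mul, map_add, aeval_X, MvPolynomial.aeval_C,
      Function.update_of_ne hL0, Function.update_of_ne h10]
  obtain ⟨N, q, R, hdiv, hRx⟩ := div_rem U hUx P
  rw [← hQp] at hdiv
  obtain ⟨N', Mr, hMr⟩ := yrev M
  obtain ⟨Φ, hΦ⟩ : ∃ Φ : MvPolynomial (Fin (2 + 1)) ℚ, Φ = X (Fin.last 2) ^ M₀ * Mr := ⟨_, rfl⟩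
  obtain ⟨D, hD⟩ : ∃ D : MvPolynomial (Fin (2 + 1)) ℚ,
    D = X (Fin.last 2) ^ N' * (W ^ (k + 1) * Qp) := ⟨_, rfl⟩
  -- symbolic partial derivatives
  have hW0 : pderiv 0 W = 0 := by
    rw [hW, map_add, pderiv_C, Derivation.leibniz, pderiv_C, pderiv_X_of_ne h10]
    simp
  have hW1 : pderiv 1 W = C β := by
    rw [hW, map_add, pderiv_C, Derivation.leibniz, pderiv_C, pderiv_X_self]
    simp
  have hU0 : pderiv 0 U = 0 := by
    rw [hU, Derivation.leibniz, hW0, pderiv_X_of_ne hL0]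
    simp
  have hU1 : pderiv 1 U = X (Fin.last 2) * C β := by
    rw [hU, Derivation.leibniz, hW1, pderiv_X_of_ne hL1]
    simp
  have hQ0 : pderiv 0 Qp = -U := by
    rw [hQp, map_sub, Derivation.map_one_eq_zero, Derivation.leibniz, pderiv_X_self, hU0]
    simp
  have hQ1 : pderiv 1 Qp = -(X 0 * (X (Fin.last 2) * C β)) := by
    rw [hQp, map_sub, Derivation.map_one_eq_zero, Derivation.leibniz, pderiv_X_of_ne h10.symm, hU1]
    simp
  have hUN : pderiv 0 (U ^ N) = 0 := by
    rw [Derivation.leibniz_pow, hU0, smul_zero, smul_zero]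
  have hZ0 : pderiv 0 (X (Fin.last 2) ^ N' : MvPolynomial (Fin (2 + 1)) ℚ) = 0 := by
    rw [Derivation.leibniz_pow, pderiv_X_of_ne hL0, smul_zero, smul_zero]
  have hZ1 : pderiv 1 (X (Fin.last 2) ^ N' : MvPolynomial (Fin (2 + 1)) ℚ) = 0 := by
    rw [Derivation.leibniz_pow, pderiv_X_of_ne hL1, smul_zero, smul_zero]
  have hD0 : pderiv 0 D = X (Fin.last 2) ^ N' * (W ^ (k + 1) * -U) := by
    rw [hD, Derivation.leibniz, hZ0, Derivation.leibniz, Derivation.leibniz_pow, hW0, hQ0]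
    simp
  have hD1 : pderiv 1 D = X (Fin.last 2) ^ N' *
      (((k : MvPolynomial (Fin (2 + 1)) ℚ) + 1) * W ^ k * C β * Qp +
        W ^ (k + 1) * -(X 0 * (X (Fin.last 2) * C β))) := by
    rw [hD, Derivation.leibniz, hZ1, Derivation.leibniz, Derivation.leibniz_pow, hW1, hQ1,
      Nat.add_sub_cancel]
    simp only [smul_eq_mul, nsmul_eq_mul, Nat.cast_add, Nat.cast_one]
    ring
  have hA1 : pderiv 0 (-(C β * X 0 * W * Φ)) = -(C β * W * Φ + C β * X 0 * W * pderiv 0 Φ) := by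
    rw [map_neg, Derivation.leibniz, Derivation.leibniz, hW0, Derivation.leibniz, pderiv_X_self,
      pderiv_C]
    simp only [smul_eq_mul, mul_one]
    ring
  have hA2 : pderiv 1 (W ^ 2 * Φ) = 2 * W * C β * Φ + W ^ 2 * pderiv 1 Φ := by
    rw [Derivation.leibniz, Derivation.leibniz_pow, hW1]
    simp only [smul_eq_mul, nsmul_eq_mul, Nat.cast_ofNat, Nat.add_one_sub_one, pow_one]
    ring
  -- evaluation of the data at `(w, ϖ₀)`
  have hWr : ∀ w ∈ KZ.cube 2, (0 : ℝ) < α + β * w 1 := fun w hw => by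
    have hs := KZ.mem_cube.1 hw 1
    have : (0 : ℝ) < α := by exact_mod_cast hα
    have : (0 : ℝ) ≤ β := by exact_mod_cast hβ.le
    nlinarith [hs.1]
  have heW : ∀ w : Fin 2 → ℝ, aeval (Fin.snoc w ϖ₀ : Fin (2 + 1) → ℝ) W = α + β * w 1 := by
    intro w
    have hv1 : (Fin.snoc w ϖ₀ : Fin (2 + 1) → ℝ) 1 = w 1 := rfl
    simp [hW, hv1]
  have heU : ∀ w : Fin 2 → ℝ, aeval (Fin.snoc w ϖ₀ : Fin (2 + 1) → ℝ) U = ϖ₀ * (α + β * w 1) := by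
    intro w
    rw [hU, map_mul, aeval_X, Fin.snoc_last, heW]
  have heD : ∀ w : Fin 2 → ℝ, aeval (Fin.snoc w ϖ₀ : Fin (2 + 1) → ℝ) D =
      ϖ₀ ^ N' * ((α + β * w 1) ^ (k + 1) * aeval (Fin.snoc w ϖ₀ : Fin (2 + 1) → ℝ) Qp) := by
    intro w
    rw [hD, map_mul, map_pow, aeval_X, Fin.snoc_last, map_mul, map_pow, heW]
  refine ⟨3, ![0, 0, 1], ![antider q, -(C β * X 0 * W * Φ), W ^ 2 * Φ], ![U ^ N, D, D],
    fun j w hw => ?_, fun w hw => ?_⟩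
  · -- the denominators `U^N`, `ϖ^{N'} W^{k+1} Q` do not vanish on the closed square at `ϖ₀`
    have hUv : aeval (Fin.snoc w ϖ₀ : Fin (2 + 1) → ℝ) (U ^ N) ≠ 0 := by
      rw [map_pow, heU]
      exact pow_ne_zero _ (mul_ne_zero hϖ₀.ne' (hWr w hw).ne')
    have hDv : aeval (Fin.snoc w ϖ₀ : Fin (2 + 1) → ℝ) D ≠ 0 := by
      rw [heD]
      exact mul_ne_zero (pow_ne_zero _ hϖ₀.ne')
        (mul_ne_zero (pow_ne_zero _ (hWr w hw).ne') (hQ w hw))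
    fin_cases j
    · simpa using hUv
    · simpa using hDv
    · simpa using hDv
  · -- the pointwise identity on the closed square at `ϖ₀`
    obtain ⟨Wv, hWv⟩ : ∃ Wv : ℝ, (α : ℝ) + β * w 1 = Wv := ⟨_, rfl⟩
    have hWne : Wv ≠ 0 := hWv ▸ (hWr w hw).ne'
    have hp : ϖ₀ ≠ 0 := hϖ₀.ne'
    obtain ⟨f, hf⟩ : ∃ f : Fin (2 + 1) → ℝ, f = Fin.snoc w ϖ₀ := ⟨_, rfl⟩
    rw [← hf]
    have hQv : aeval f Qp ≠ 0 := by rw [hf]; exact hQ w hw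
    have hv0 : f 0 = w 0 := by rw [hf]; rfl
    have hv1 : f 1 = w 1 := by rw [hf]; rfl
    have hv2 : f (Fin.last 2) = ϖ₀ := by rw [hf, Fin.snoc_last]
    have heWf : aeval f W = Wv := by rw [hf, heW, hWv]
    have heUf : aeval f U = ϖ₀ * Wv := by rw [hf, heU, hWv]
    have heDf : aeval f D = ϖ₀ ^ N' * (Wv ^ (k + 1) * aeval f Qp) := by rw [hf, heD, hWv]
    -- `Φ = ϖ^{M₀} M̂` along the slices through `f`, and its partial derivatives there
    have hΦv : ∀ g : Fin (2 + 1) → ℝ, g (Fin.last 2) = ϖ₀ →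
        aeval g Φ = ϖ₀ ^ M₀ * (ϖ₀ ^ N' * aeval ![ϖ₀⁻¹, g 1] M) := by
      intro g hg
      rw [hΦ, map_mul, map_pow, aeval_X, hMr g (by rw [hg]; exact hp), hg]
    have heΦ : aeval f Φ = ϖ₀ ^ M₀ * (ϖ₀ ^ N' * aeval ![ϖ₀⁻¹, w 1] M) := by rw [hΦv f hv2, hv1]
    have heΦ0 : aeval f (pderiv 0 Φ) = 0 := by
      have h1 := KZ.hasDerivAt_aeval_update Φ f 0 (f 0)
      rw [Function.update_eq_self] at h1
      have h2 : HasDerivAt (fun t : ℝ => aeval (Function.update f 0 t) Φ) 0 (f 0) := by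
        have : (fun t : ℝ => aeval (Function.update f 0 t) Φ) =
            fun _ => ϖ₀ ^ M₀ * (ϖ₀ ^ N' * aeval ![ϖ₀⁻¹, w 1] M) := by
          funext t
          rw [hΦv _ (by rw [Function.update_of_ne hL0, hv2]), Function.update_of_ne h10, hv1]
        rw [this]
        exact hasDerivAt_const _ _
      exact h1.unique h2
    have heΦ1 : aeval f (pderiv 1 Φ) = ϖ₀ ^ M₀ * (ϖ₀ ^ N' * aeval ![ϖ₀⁻¹, w 1] (pderiv 1 M)) := by
      have h1 := KZ.hasDerivAt_aeval_update Φ f 1 (f 1)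
      rw [Function.update_eq_self, hv1] at h1
      have h2 : HasDerivAt (fun t : ℝ => aeval (Function.update f 1 t) Φ)
          (ϖ₀ ^ M₀ * (ϖ₀ ^ N' * aeval ![ϖ₀⁻¹, w 1] (pderiv 1 M))) (w 1) := by
        have : (fun t : ℝ => aeval (Function.update f 1 t) Φ) =
            fun t => ϖ₀ ^ M₀ * (ϖ₀ ^ N' * aeval ![ϖ₀⁻¹, t] M) := by
          funext t
          rw [hΦv _ (by rw [Function.update_of_ne hL1, hv2]), Function.update_self]
        rw [this]
        exact ((hasDerivAt_aeval_snd M ϖ₀⁻¹ (w 1)).const_mul _).const_mul _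
      exact h1.unique h2
    -- the residue datum at `y = ϖ₀⁻¹`, and the reversal identity at the polar point `z`
    obtain ⟨z, hz⟩ : ∃ z : Fin 2 → ℝ, z = ![ϖ₀⁻¹ / Wv, w 1] := ⟨_, rfl⟩
    have hz0 : z 0 = ϖ₀⁻¹ / Wv := by rw [hz]; rfl
    have hz1 : z 1 = w 1 := by rw [hz]; rfl
    have hk := key_identity α β Pt k M hM ϖ₀⁻¹ (w 1) (hWr w hw).ne'
    rw [hWv, ← hz] at hk
    have hT : ((α : ℝ) + β * z 1) * z 0 = ϖ₀⁻¹ := by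
      rw [hz1, hWv, hz0]
      field_simp
    have hPz := hPt z (by rw [hT]; exact inv_ne_zero hp)
    rw [hT, inv_inv] at hPz
    -- the division identity at `f` and at the polar point `Fin.snoc z ϖ₀ = f[0 ↦ 1/U]`
    have hupd : Function.update f 0 (ϖ₀⁻¹ / Wv) = Fin.snoc z ϖ₀ := by
      funext l
      refine Fin.lastCases ?_ (fun j => ?_) l
      · rw [Function.update_of_ne hL0, hv2, Fin.snoc_last]
      · rw [Fin.snoc_castSucc]
        fin_cases j
        · simp [hz0]
        · simp [hv1, hz1]
    have hR2 : aeval (Fin.snoc z ϖ₀ : Fin (2 + 1) → ℝ) R = aeval f R := by rw [← hupd, hRx]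
    have hQz : aeval (Fin.snoc z ϖ₀ : Fin (2 + 1) → ℝ) Qp = 0 := by
      have hzv : (Fin.snoc z ϖ₀ : Fin (2 + 1) → ℝ) 0 = z 0 := rfl
      have h1 : ϖ₀ * Wv * (ϖ₀⁻¹ / Wv) = 1 := by field_simp
      rw [hQp, map_sub, map_one, map_mul, aeval_X, heU z, hzv, hz1, hWv, hz0, h1, sub_self]
    have h1 := congrArg (aeval f) hdiv
    have h2 := congrArg (aeval (Fin.snoc z ϖ₀ : Fin (2 + 1) → ℝ)) hdiv
    simp only [map_mul, map_pow, map_add, heUf] at h1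
    simp only [map_mul, map_pow, map_add, heU z, hz1, hWv, hQz, mul_zero, zero_add, hR2] at h2
    -- expand the sum and evaluate
    have hc0 : (Fin.castSucc (0 : Fin 2) : Fin (2 + 1)) = 0 := rfl
    have hc1 : (Fin.castSucc (1 : Fin 2) : Fin (2 + 1)) = 1 := rfl
    simp only [Fin.sum_univ_three, Matrix.cons_val_zero, Matrix.cons_val_one, Matrix.cons_val_two,
      Matrix.tail_cons, Matrix.head_cons, hc0, hc1]
    rw [pderiv_antider, hUN, hA1, hD0, hA2, hD1]
    simp only [map_sub, map_mul, map_neg, map_add, map_pow, map_natCast, map_one, map_ofNat,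
      MvPolynomial.aeval_C, aeval_X, eq_ratCast, hv0, hv2, heWf, heUf, heDf, heΦ, heΦ0, heΦ1,
      mul_zero, add_zero, sub_zero]
    -- the rational identity
    have hE : (ϖ₀ * Wv) ^ N ≠ 0 := pow_ne_zero _ (mul_ne_zero hp hWne)
    have hPv : aeval f P = (aeval f q * aeval f Qp +
        (ϖ₀ * Wv) ^ N * aeval (Fin.snoc z ϖ₀ : Fin (2 + 1) → ℝ) P) / (ϖ₀ * Wv) ^ N := by
      rw [eq_div_iff hE]
      linear_combination h1 - h2
    have hPs : aeval (Fin.snoc z ϖ₀ : Fin (2 + 1) → ℝ) P = ϖ₀ ^ M₀ * aeval z Pt := by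
      rw [hPz, ← mul_assoc, ← mul_pow, mul_inv_cancel₀ hp, one_pow, one_mul]
    have hPtV : aeval z Pt = (aeval ![ϖ₀⁻¹, w 1] (pderiv 1 M) * Wv -
        k * β * aeval ![ϖ₀⁻¹, w 1] M) / Wv ^ k := by
      rw [eq_div_iff (pow_ne_zero _ hWne), hk]
    rw [hPv, hPs, hPtV]
    field_simp
    ring
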